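import Literature.MathematicalPhysics.QuantumFieldTheory.Balaban1983to89.B4StripSums

/-!
# Road FP (binder row D1), leaf H′2-IR ∕ IR-4b (part A): THE INVERSE SYMBOL OF THE BLOCKED MASSLESS COVARIANCE `Q′G₀Q′ᵀ` IS STRIP REGULAR
# UNIFORMLY IN THE BLOCK SIDE `n` — `|F| ≥ ½(4∕π²)^d` on an `n`-free strip, and the coarse inverse kernel decays exponentially, `n`-uniformly
# (Gawędzki–Kupiainen 1980 Prop. A.2, for ARBITRARY block side, as a theorem over the tree's B4 strip machinery)

HONEST DEPENDENCY (page 1, mandatory): continuum YM on T⁴ ⇐ BetaPertH ∧ nine spine estimates (0/9 proved); BetaPertH ⇐ (D1) ∧ (D4) ∧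
CAP+tail; G-an2-4 gates asym, D1 and NE2/3/4.  HONEST FRAMING (cell contract, verbatim): «discharging `BetaPertH` makes Bałaban's UV
stability UNCONDITIONAL — a real constructive-QFT result; it is NOT the continuum limit and NOT the Clay problem.»  THIS MODULE is [folklore]
complex analysis over the tree's B4 strip modules BY NAME (`B4Strip`: the symbols `Sxi`, `DeltaXi`, `U`, `shift`, the regrouped denominator
`E`, `Er_ge`'s pieces `Ur_zero_ge`∕`Ur_nonneg`∕`DeltaXir_nonneg`, the modulus lemma `strip_lower_bound`; `B4StripCauchy`: the fat region, Cauchy's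
estimate `imLipschitz_of_fat`, `norm_E_le`, `norm_DeltaXi_le`, `rOf`; `B5Strip145Analytic`: `differentiableAt_E`, `differentiableAt_DeltaXi`, the
shift law `E_tr`, edge positivity `re_DeltaXi_pos_of_edge`, `kappa_small`; `B5Strip145Decay`: the `insertNth` side helpers; `B4ContourShift`:
`StripRegular`, `latticeKernel_decay`).  No `def`, no `def … : Prop`, nothing cited, 0 sorry; it asserts NOTHING of Bałaban's papers and
discharges NOTHING of H′2-IR ∕ `hasym` ∕ D1 by itself (it is the DECAY HALF of the coarse letter (H-CINV) of row IR-4; the identity half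
`C·M = δ` — alias formula + convolution — is part B).  0∕4 binders of row D1; NOT D1, NOT BetaPertH, NOT continuum, NOT Clay.

ABSOLUTE RULE (cell charter, verbatim): «No internally-minted statement may enter as a cited fact. Every hypothesis is either kernel-proved
in this package or a verbatim quotation of a PUBLISHED theorem with page reference. The manuscript(s) under audit are NOT citable for their
own disputed steps — they are the thing under adjudication; programme-internal (2001/route/tribunal) claims are never citable.»

THE READING (owner's `OWNER-RULINGS-FP-5.md` R-FP-18 (c) IR-4 «ghost analogue … GK 1980 Prop. A.2»; leaf-05-g9's (H-CINV) l.20977; this seat's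
located route l.≈21175).  On `ℤ^d` with block side `n`, the UNNORMALISED blocked free covariance `M(v − w) = Σ_{b,b′ ∈ [0,n)^d} G₀(n•v + b − n•w − b′)`
(`G₀ = (−Δ)⁻¹`) has the coarse Fourier symbol `M̂(p′) = n^{d+2} · m_n(p′)`, `m_n(p′) = Σ_{k ∈ (ℤ∕n)^d} U_k(p′) ∕ Δ^ξ(p′ + 2πk)` — the alias sum
of B4 (2.49) ∕ GK (A.1) (`ξ = 1∕n`; in the tree's names `U n k`, `DeltaXi n 0 (shift n k ·)`; `m_n = Bfac n 1 0 − 1`).  It blows up like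
`|p′|⁻²` at the zero mode, but its INVERSE is entire-over-nonvanishing: with
  **`F(p′) := E n 1 0 p′ − DeltaXi n 0 p′ = U₀(p′) + Σ_{k ≠ 0} U_k(p′)·Δ^ξ(p′)∕Δ^ξ(p′+2πk)`**   (B4's regrouped bracket at `a = 1`, `m² = 0`,
  WITHOUT its leading `Δ^ξ`) one has `m_n = F ∕ Δ^ξ`, so **`1∕m_n = Δ^ξ ∕ F`** (`DeltaXi n 0 p′ ∕ F(p′)`).  §1: on real momenta
`F ≥ U₀ ≥ (4∕π²)^d` (Jordan; the other terms are `≥ 0`), `|F| ≤ M_E + 16d` and `F` is slice-holomorphic on the fat region, whence by Cauchy's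
estimate the imaginary-direction Lipschitz bound and, by `strip_lower_bound`, **`|F| ≥ ½(4∕π²)^d` on `Strip d κ_F(d)`** with `κ_F(d) > 0`
INDEPENDENT OF `n ≥ 1` (§2).  §3: `Δ^ξ∕F` is `2π`-periodic across the sides of the strip (shift law `E_tr`: `E∕Δ^ξ` is periodic), continuous,
slice-holomorphic and bounded by `16(d+1)∕c_F` there: `StripRegular (Δ^ξ∕F) κ (32(d+1)(π²∕4)^{d+1})` for every `0 ≤ κ ≤ κ_F(d+1)` and EVERY
`n ≥ 1` (§3), so `B4ContourShift.latticeKernel_decay` gives the `n`-UNIFORM exponential decay of the coarse inverse kernel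
`K[Δ^ξ∕F](w)` — `|K(w)| ≤ 32(d+1)(π²∕4)^{d+1}·e^{−κ‖w‖_∞}` (§4).  Dictionary to (H-CINV): `C u v = n^{−(d+2)}·Re K[Δ^ξ∕F](u − v)` (part B proves
`C·M = δ`; here only the decay, which is the GK content).
Unit `b2b-balaban-beta-d1-formalise-leaf-06` (gen 7), 2026-08-20; `LEAVES-FP.md` row H′2-IR ∕ IR-4 (sub-row IR-4b); journal l.20936 ∕ l.≈21175.
-/

namespace Summit.QuantumFields.BalabanUV.Beta.FP.CoarseCovarianceSymbol

open Complex Finset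
open Literature.MathematicalPhysics.QuantumFieldTheory.Balaban1983to89
open B4Strip B4StripCauchy B5Strip145Analytic B5Strip145Decay B4ContourShift
open B4StripSums (tr_mem_Strip)
open scoped Real

noncomputable section

variable {d : ℕ}

/-! ## §1 The symbol `F = E(1,0) − Δ^ξ` on real momenta and on the fat region -/

/-- [folklore] On real momenta `F = Er n 1 0 − DeltaXir n 0` is real. -/
theorem F_ofReal (n : ℕ) [NeZero n] (s : Fin d → ℝ) :
    E n 1 0 (ofRealVec s) - DeltaXi n 0 (ofRealVec s) = ((Er n 1 0 s - DeltaXir n 0 s : ℝ) : ℂ) := by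
  rw [E_ofReal, DeltaXi_ofReal]; push_cast; ring

/-- [folklore] REAL POSITIVITY: `Er n 1 0 s − DeltaXir n 0 s = U₀(s) + Σ_{k≠0} U_k(s)·Δ^ξ(s)∕Δ^ξ(s+2πk) ≥ (4∕π²)^d` on the Brillouin zone,
for every `n ≥ 1` (the `U₀` term alone, `B4Strip.Ur_zero_ge`; the rest is `≥ 0`). -/
theorem Fr_ge (n : ℕ) [NeZero n] (s : Fin d → ℝ) (hs : ∀ μ, |s μ| ≤ Real.pi) :
    (4 / Real.pi ^ 2) ^ d ≤ Er n 1 0 s - DeltaXir n 0 s := by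
  have hn : 1 ≤ n := Nat.one_le_iff_ne_zero.mpr (NeZero.ne n)
  have h1 := DeltaXir_nonneg n 0 le_rfl s
  have h2 := Ur_zero_ge n hn s hs
  have h3 : 0 ≤ ∑ k ∈ (Finset.univ.erase (fun _ => (0 : Fin n))),
        Ur n k s * (DeltaXir n 0 s / DeltaXir n 0 (shiftr n k s)) := by
    apply Finset.sum_nonneg; intro k _
    exact mul_nonneg (Ur_nonneg _ _ _) (div_nonneg h1 (DeltaXir_nonneg n 0 le_rfl _))
  unfold Er
  linarith

/-- [folklore] … in modulus form: `‖F(s)‖ ≥ (4∕π²)^d` on real momenta. -/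
theorem norm_F_real_ge (n : ℕ) [NeZero n] (s : Fin d → ℝ) (hs : ∀ μ, |s μ| ≤ Real.pi) :
    (4 / Real.pi ^ 2) ^ d ≤ ‖E n 1 0 (ofRealVec s) - DeltaXi n 0 (ofRealVec s)‖ := by
  rw [F_ofReal, Complex.norm_real]
  exact (Fr_ge n s hs).trans (le_abs_self _)

/-- [folklore] The `n`-UNIFORM bound of `F` on the fat region `F_r` (`r ≤ 1∕4`, `d r² ≤ 1∕16`): `‖F‖ ≤ M_E(d,1,0) + 16d`. -/
theorem norm_F_le (n : ℕ) [NeZero n] {r : ℝ} (hr : r ≤ 1 / 4) (hdr : (d : ℝ) * r ^ 2 ≤ 1 / 16) {q : Fin d → ℂ} (hq : q ∈ Fat d r) :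
    ‖E n 1 0 q - DeltaXi n 0 q‖ ≤ boundM d 1 0 + 16 * d := by
  have hn : 1 ≤ n := Nat.one_le_iff_ne_zero.mpr (NeZero.ne n)
  calc ‖E n 1 0 q - DeltaXi n 0 q‖ ≤ ‖E n 1 0 q‖ + ‖DeltaXi n 0 q‖ := norm_sub_le _ _
    _ ≤ boundM d |(1:ℝ)| 0 + (16 * d + 0) := add_le_add (norm_E_le n 1 0 0 le_rfl le_rfl hr hdr hq) (norm_DeltaXi_le n hn 0 le_rfl hr hq)
    _ = boundM d 1 0 + 16 * d := by rw [abs_one, add_zero]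

/-- [folklore] `F` is holomorphic (jointly) at every point of the fat region. -/
theorem differentiableAt_F (n : ℕ) [NeZero n] {r : ℝ} (hr : r ≤ 1 / 4) (hdr : (d : ℝ) * r ^ 2 ≤ 1 / 16) {q : Fin d → ℂ}
    (hq : q ∈ Fat d r) : DifferentiableAt ℂ (fun p => E n 1 0 p - DeltaXi n 0 p) q :=
  (differentiableAt_E n 1 0 le_rfl hr hdr hq).sub (differentiableAt_DeltaXi n 0 q)

/-- [folklore] … hence every coordinate slice of `F` through a fat point is holomorphic there. -/
theorem differentiableAt_F_slice (n : ℕ) [NeZero n] {r : ℝ} (hr : r ≤ 1 / 4) (hdr : (d : ℝ) * r ^ 2 ≤ 1 / 16) {q : Fin d → ℂ}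
    (hq : q ∈ Fat d r) (μ : Fin d) : DifferentiableAt ℂ (fun w => E n 1 0 (Function.update q μ w) - DeltaXi n 0 (Function.update q μ w)) (q μ) := by
  have h := differentiableAt_F n hr hdr hq
  rw [← Function.update_eq_self μ q] at h
  exact h.comp (q μ) (differentiableAt_update q μ (q μ))

/-- [folklore] THE DICTIONARY: where `Δ^ξ(p′) ≠ 0`, `F = Δ^ξ · m_n` with the alias sum `m_n(p′) = Σ_k U_k(p′)∕Δ^ξ(p′+2πk)`
(`= Bfac n 1 0 − 1`, `B5Strip145Analytic.E_eq_DeltaXi_mul_Bfac`). -/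
theorem F_eq_DeltaXi_mul (n : ℕ) [NeZero n] (p : Fin d → ℂ) (h0 : DeltaXi n 0 p ≠ 0) :
    E n 1 0 p - DeltaXi n 0 p = DeltaXi n 0 p * ∑ k : Fin d → Fin n, U n k p / DeltaXi n 0 (shift n k p) := by
  rw [E_eq_DeltaXi_mul_Bfac n 1 0 p h0]
  unfold Bfac
  push_cast
  ring

/-- [folklore] … so `Δ^ξ∕F = 1∕m_n` is THE INVERSE OF THE COARSE SYMBOL (where `Δ^ξ(p′) ≠ 0`; in Lean's `x∕0 = 0` convention no further
side condition is needed). -/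
theorem invSymbol_eq (n : ℕ) [NeZero n] (p : Fin d → ℂ) (h0 : DeltaXi n 0 p ≠ 0) :
    DeltaXi n 0 p / (E n 1 0 p - DeltaXi n 0 p) = (∑ k : Fin d → Fin n, U n k p / DeltaXi n 0 (shift n k p))⁻¹ := by
  rw [F_eq_DeltaXi_mul n p h0, div_mul_eq_div_div, div_self h0, one_div]

/-! ## §2 The `n`-uniform lower bound of `F` on a strip -/

/-- [folklore] The imaginary-direction Lipschitz bound of `F` on every strip of half-width `κ ≤ rOf d`, constant `(M_E + 16d)∕r`, uniform in `n`. -/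
theorem F_imLipschitz (n : ℕ) [NeZero n] {κ : ℝ} (hκ0 : 0 ≤ κ) (hκr : κ ≤ rOf d) :
    ∀ p ∈ Strip d κ, ‖(E n 1 0 p - DeltaXi n 0 p) - (E n 1 0 (ofRealVec (reVec p)) - DeltaXi n 0 (ofRealVec (reVec p)))‖
      ≤ (boundM d 1 0 + 16 * d) / rOf d * ∑ μ, |(p μ).im| :=
  imLipschitz_of_fat (fun p => E n 1 0 p - DeltaXi n 0 p) (rOf_pos d) hκ0 hκr
    (fun _ hq μ => differentiableAt_F_slice n (rOf_le d) (d_mul_rOf_sq_le d) hq μ)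
    (fun _ hq => norm_F_le n (rOf_le d) (d_mul_rOf_sq_le d) hq)

/-- [folklore] **THE `n`-UNIFORM STRIP LOWER BOUND**: with `c_F = ½(4∕π²)^d`, `Λ_F = (M_E + 16d)∕r` and
`κ_F = min(r, c_F∕(Λ_F d + 1))` (all functions of `d` alone) one has `κ_F > 0` and `|F(p′)| ≥ c_F` on `Strip d κ_F`, for EVERY `n ≥ 1`. -/
theorem F_lower (d : ℕ) :
    0 < min (rOf d) ((4 / Real.pi ^ 2) ^ d / 2 / ((boundM d 1 0 + 16 * d) / rOf d * d + 1)) ∧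
    ∀ (n : ℕ) [NeZero n], ∀ p ∈ Strip d (min (rOf d) ((4 / Real.pi ^ 2) ^ d / 2 / ((boundM d 1 0 + 16 * d) / rOf d * d + 1))),
      (4 / Real.pi ^ 2) ^ d / 2 ≤ ‖E n 1 0 p - DeltaXi n 0 p‖ := by
  set Λ : ℝ := (boundM d 1 0 + 16 * d) / rOf d with hΛdef
  set c : ℝ := (4 / Real.pi ^ 2) ^ d / 2 with hc
  have hcpos : 0 < c := by positivity
  have hΛ : 0 ≤ Λ := div_nonneg (add_nonneg (boundM_nonneg d zero_le_one 0) (by positivity)) (rOf_pos d).le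
  have hden : 0 < Λ * d + 1 := by positivity
  set κ := min (rOf d) (c / (Λ * d + 1)) with hκ
  have hκpos : 0 < κ := lt_min (rOf_pos d) (div_pos hcpos hden)
  refine ⟨hκpos, fun n _ => ?_⟩
  have hκr : κ ≤ rOf d := min_le_left _ _
  have hsmall : Λ * (d * κ) ≤ c := by
    have h1 : κ ≤ c / (Λ * d + 1) := min_le_right _ _
    have h2 : Λ * d * κ ≤ Λ * d * (c / (Λ * d + 1)) := mul_le_mul_of_nonneg_left h1 (by positivity)
    have h3 : Λ * d * (c / (Λ * d + 1)) ≤ c := by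
      rw [mul_div_assoc']
      rw [div_le_iff₀ hden]
      nlinarith [mul_nonneg hΛ (Nat.cast_nonneg d), hcpos]
    nlinarith
  refine strip_lower_bound (fun p => E n 1 0 p - DeltaXi n 0 p) c Λ κ ?_ (F_imLipschitz n hκpos.le hκr) hΛ hsmall
  intro s hs
  have := norm_F_real_ge n s hs
  rw [hc]; linarith

/-! ## §3 Strip regularity of the inverse coarse symbol `Δ^ξ ∕ F` -/

/-- [folklore] A point of the strip with a coordinate on a side has that coordinate `≠ 0` and `≠ −2π`. -/
theorem side_ne {p : Fin d → ℂ} (μ : Fin d) (hre : (p μ).re = -Real.pi) : p μ ≠ 0 ∧ p μ + 2 * Real.pi ≠ 0 := by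
  have hπ := Real.pi_pos
  refine ⟨fun h => ?_, fun h => ?_⟩
  · rw [h, Complex.zero_re] at hre; linarith
  · have := congrArg Complex.re h
    simp only [Complex.add_re, Complex.zero_re] at this
    rw [hre] at this
    norm_num at this
    linarith

/-- [folklore] **SIDE PERIODICITY OF `Δ^ξ∕F`**: at a strip point with `Re p_μ = −π` (`κ ≤ 1`, `d κ² ≤ 1∕16`), if `F ≠ 0` at `p` and at `p + 2πe_μ`,
`(Δ^ξ∕F)(p + 2πe_μ) = (Δ^ξ∕F)(p)` — from the shift law `E(p+2πe_μ)·Δ^ξ(p) = Δ^ξ(p+2πe_μ)·E(p)` (`E_tr`) and edge positivity of `Δ^ξ`. -/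
theorem invSymbol_tr_side (n : ℕ) [NeZero n] {κ : ℝ} (hκ1 : κ ≤ 1) (hdκ : (d : ℝ) * κ ^ 2 ≤ 1 / 16) {p : Fin d → ℂ}
    (hp : p ∈ Strip d κ) (μ : Fin d) (hre : (p μ).re = -Real.pi)
    (hF0 : E n 1 0 p - DeltaXi n 0 p ≠ 0) (hF1 : E n 1 0 (tr p μ) - DeltaXi n 0 (tr p μ) ≠ 0) :
    DeltaXi n 0 (tr p μ) / (E n 1 0 (tr p μ) - DeltaXi n 0 (tr p μ)) = DeltaXi n 0 p / (E n 1 0 p - DeltaXi n 0 p) := by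
  have hπ := Real.pi_pos
  obtain ⟨hz, hz'⟩ := side_ne μ hre
  have h0 : DeltaXi n 0 p ≠ 0 := by
    intro h
    have := re_DeltaXi_pos_of_edge n 0 le_rfl hκ1 hdκ (fun ν => (hp ν).2) μ (by rw [hre, abs_neg, abs_of_pos hπ])
    rw [h, Complex.zero_re] at this
    exact lt_irrefl _ this
  have h1 : DeltaXi n 0 (tr p μ) ≠ 0 := by
    intro h
    have := re_DeltaXi_pos_of_edge n 0 le_rfl hκ1 hdκ (q := tr p μ) (fun ν => by rw [tr_im]; exact (hp ν).2) μ
      (by rw [tr_re_self, hre]; ring_nf; exact abs_of_pos hπ)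
    rw [h, Complex.zero_re] at this
    exact lt_irrefl _ this
  have hEtr := E_tr n 1 0 p μ hz hz' h0 h1
  rw [div_eq_div_iff hF1 hF0]
  linear_combination -hEtr

/-- [folklore] **STRIP REGULARITY OF THE INVERSE COARSE SYMBOL** `Δ^ξ∕F`, in the sense of `B4ContourShift.StripRegular`, on every strip
`Strip (d+1) κ` with `0 ≤ κ ≤ rOf (d+1)` on which `|F| ≥ c > 0`: continuous, slice-holomorphic, periodic across the sides, bounded by `16(d+1)∕c`
— for EVERY block side `n ≥ 1`. -/
theorem stripRegular_invSymbol (n : ℕ) [NeZero n] {κ c : ℝ} (hκ0 : 0 ≤ κ) (hκr : κ ≤ rOf (d + 1)) (hc : 0 < c)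
    (hF : ∀ p ∈ Strip (d + 1) κ, c ≤ ‖E n 1 0 p - DeltaXi n 0 p‖) :
    StripRegular (d := d) (fun p => DeltaXi n 0 p / (E n 1 0 p - DeltaXi n 0 p)) κ (16 * (d + 1) / c) := by
  obtain ⟨hκ1, hdκ⟩ := kappa_small hκ0 hκr
  have hn : 1 ≤ n := Nat.one_le_iff_ne_zero.mpr (NeZero.ne n)
  have hfat : Strip (d + 1) κ ⊆ Fat (d + 1) (rOf (d + 1)) := strip_subset_fat (rOf_pos _).le hκr
  have hne : ∀ p ∈ Strip (d + 1) κ, E n 1 0 p - DeltaXi n 0 p ≠ 0 := by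
    intro p hp h
    have := hF p hp
    rw [h, norm_zero] at this
    linarith
  have hdiffAt : ∀ p ∈ Strip (d + 1) κ, DifferentiableAt ℂ (fun p => DeltaXi n 0 p / (E n 1 0 p - DeltaXi n 0 p)) p := by
    intro p hp
    have h := (differentiableAt_DeltaXi n 0 p).mul ((differentiableAt_F n (rOf_le _) (d_mul_rOf_sq_le _) (hfat hp)).inv (hne p hp))
    refine h.congr_of_eventuallyEq (Filter.Eventually.of_forall fun q => ?_)
    simp only [Pi.mul_apply, Pi.inv_apply, div_eq_mul_inv]
  refine ⟨?_, ?_, ?_, ?_⟩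
  · exact fun p hp => (hdiffAt p hp).continuousAt.continuousWithinAt
  · intro i q hq z hz
    have hP : i.insertNth z (ofRealVec q) ∈ Strip (d + 1) κ :=
      insertNth_mem_Strip hκ0 i hq (openRect_subset_closedRect κ hz)
    exact ((hdiffAt _ hP).comp z (differentiableAt_insertNth i _ z)).differentiableWithinAt
  · intro i q hq y hy
    obtain ⟨hP, hre⟩ := insertNth_left_mem hκ0 i hq hy
    rw [← tr_insertNth_left]
    have hP' := tr_mem_Strip hP i hre
    exact (invSymbol_tr_side n hκ1 hdκ hP i hre (hne _ hP) (hne _ hP')).symm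
  · intro p hp
    rw [norm_div, div_le_div_iff₀ (lt_of_lt_of_le hc (hF p hp)) hc]
    have h1 : ‖DeltaXi n 0 p‖ ≤ 16 * (d + 1 : ℕ) + 0 := norm_DeltaXi_le n hn 0 le_rfl (rOf_le _) (hfat hp)
    push_cast at h1
    rw [add_zero] at h1
    calc ‖DeltaXi n 0 p‖ * c ≤ (16 * (d + 1)) * c := mul_le_mul_of_nonneg_right h1 hc.le
      _ ≤ 16 * (d + 1) * ‖E n 1 0 p - DeltaXi n 0 p‖ := mul_le_mul_of_nonneg_left (hF p hp) (by positivity)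

/-! ## §4 The `n`-uniform exponential decay of the coarse inverse kernel -/

/-- [folklore] **GK 1980 PROP. A.2 FOR ARBITRARY BLOCK SIDE, MULTIPLIER FORM**: there is `κ > 0` (a function of `d` alone) such that for EVERY
`n ≥ 1` the inverse coarse symbol `Δ^ξ∕F = 1∕m_n` of the blocked massless covariance is `StripRegular` on `Strip (d+1) κ` with the `n`-free
bound `32(d+1)·((4∕π²)^{d+1})⁻¹`. -/
theorem invSymbol_stripRegular (d : ℕ) : ∃ κ : ℝ, 0 < κ ∧ ∀ (n : ℕ) [NeZero n],
    StripRegular (d := d) (fun p => DeltaXi n 0 p / (E n 1 0 p - DeltaXi n 0 p)) κ (16 * (d + 1) / ((4 / Real.pi ^ 2) ^ (d + 1) / 2)) := by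
  obtain ⟨hκ, hF⟩ := F_lower (d + 1)
  refine ⟨_, hκ, fun n _ => ?_⟩
  have := stripRegular_invSymbol (d := d) n hκ.le (min_le_left _ _) (by positivity) (hF n)
  push_cast at this ⊢
  exact this

/-- [folklore] **GK 1980 PROP. A.2 FOR ARBITRARY BLOCK SIDE, KERNEL FORM — THE `n`-UNIFORM EXPONENTIAL DECAY OF THE COARSE INVERSE KERNEL**:
there is `κ > 0` (a function of `d` alone) such that for EVERY `n ≥ 1` and every `w ∈ ℤ^{d+1}`
`‖K[Δ^ξ∕F](w)‖ ≤ (32(d+1)∕(4∕π²)^{d+1})·e^{−κ‖w‖_∞}`  (`K = B4ContourShift.latticeKernel`; the coarse inverse of (H-CINV) is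
`C = n^{−(d+3)}·Re K[Δ^ξ∕F]`, dictionary in part B). -/
theorem coarseInv_decay (d : ℕ) : ∃ κ : ℝ, 0 < κ ∧ ∀ (n : ℕ) [NeZero n] (w : Fin (d + 1) → ℤ),
    ‖latticeKernel (fun p => DeltaXi n 0 p / (E n 1 0 p - DeltaXi n 0 p)) w‖
      ≤ (16 * (d + 1) / ((4 / Real.pi ^ 2) ^ (d + 1) / 2)) * Real.exp (-(κ * supNorm w)) := by
  obtain ⟨κ, hκ, h⟩ := invSymbol_stripRegular d
  exact ⟨κ, hκ, fun n _ w => latticeKernel_decay (h n) hκ.le w⟩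

end

end Summit.QuantumFields.BalabanUV.Beta.FP.CoarseCovarianceSymbol
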